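import Mathlib
import Summits.NavierStokesRegularity.NavierStokesRegularity.Theorems.EulerMelnikovDssPeriodMomentLawsHelicityForced
import Literature.Analysis.FluidPDE.ClassicalSobolevUniqueness
import Literature.Analysis.FluidPDE.WholeSpaceIBP
import Literature.Analysis.FluidPDE.RapidDecayLemmas
import HarnessLib

/-!
# Period moment laws of the rescaled Euler–Leray system, III: the drift injects no helicity;
  the HELICITY law (iv) of item stmt-NavierStokesRegularity-1419 `EulerMelnikovDss.PeriodMomentLaws`

* `integral_inner_convect_id_curl_eq_neg_helicity` — for a smooth rapidly decaying `V` on `ℝ³`,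
  `∫ ⟪DV·y, curl V⟫ = −∫ ⟪V, curl V⟫` (scale invariance of helicity): Green's formula for `⟪V, ω⟫ y`
  (`3H + ∫⟪DV y, ω⟫ + ∫⟪V, Dω y⟫ = 0`) and the self-adjointness of the curl against `Ψ = (y·∇)V`,
  `curl Ψ = ω + (y·∇)ω` (`curl_convect` with `a = id`).
* `integral_inner_drift_curl_eq_zero` — `∫ ⟪−(ε/2)(V + DV·y), curl V⟫ = 0`; `helicity_law` —
  **law (iv) of the item** (as typed): `d/dσ helicity(W) = −2ε ∫ ⟪curl W, curl curl W⟫`.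

HONEST FRAMING: calculus identities about HYPOTHETICAL smooth rapidly decaying solutions of the
rescaled system; nothing here bears on NS regularity.
-/

noncomputable section

set_option linter.dupNamespace false

namespace Summit.NavierStokesRegularity.NavierStokesRegularity.Theorems

namespace PeriodMomentLaws

open MeasureTheory Set Function Filter Topology InnerProductSpace Literature.Analysis.FluidPDE
open scoped RealInnerProductSpace NNReal ENNReal ContDiff Laplacian

/-- Product bound for pairings of weighted fields: `‖a‖ ≤ A wa`, `‖b‖ ≤ B wb`, `wb ≤ 1` give
`‖⟪a, b⟫‖ ≤ A B wa`. [folklore] -/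
theorem norm_inner_le_of_weights {a b : EuclideanSpace ℝ (Fin 3)} {A B wa wb : ℝ}
    (ha : ‖a‖ ≤ A * wa) (hb : ‖b‖ ≤ B * wb) (hA : 0 ≤ A) (hB : 0 ≤ B) (hwa : 0 ≤ wa)
    (hwb : wb ≤ 1) : ‖⟪a, b⟫‖ ≤ A * B * wa := by
  calc ‖⟪a, b⟫‖ ≤ ‖a‖ * ‖b‖ := norm_inner_le_norm _ _
    _ ≤ A * wa * (B * wb) := mul_le_mul ha hb (norm_nonneg _) (mul_nonneg hA hwa)
    _ ≤ A * wa * (B * 1) :=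
        mul_le_mul_of_nonneg_left (mul_le_mul_of_nonneg_left hwb hB) (mul_nonneg hA hwa)
    _ = A * B * wa := by ring

set_option maxHeartbeats 800000 in
/-- **`∫ ⟪DV·y, curl V⟫ = −∫ ⟪V, curl V⟫`** for a smooth field `V` on `ℝ³` with `V`, `DV`, `D²V`
decaying like `(1+|y|)^{-6}`. [cite: MajdaBertozziCUP2002, §1.7 Prop. 1.12 (iv) (helicity; scaling generator)] -/
theorem integral_inner_convect_id_curl_eq_neg_helicity
    {V : EuclideanSpace ℝ (Fin 3) → EuclideanSpace ℝ (Fin 3)} (hV : ContDiff ℝ ∞ V) {C : ℝ}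
    (h0 : ∀ y, ‖V y‖ ≤ C * (1 + ‖y‖) ^ (-(6 : ℝ)))
    (h1 : ∀ y, ‖fderiv ℝ V y‖ ≤ C * (1 + ‖y‖) ^ (-(6 : ℝ)))
    (h2 : ∀ y, ‖fderiv ℝ (fderiv ℝ V) y‖ ≤ C * (1 + ‖y‖) ^ (-(6 : ℝ))) :
    ∫ y, ⟪fderiv ℝ V y y, curl V y⟫ = -∫ y, ⟪V y, curl V y⟫ := by
  have hC : 0 ≤ C := by have := (norm_nonneg _).trans (h0 0); simpa using this
  have hr4 : (Module.finrank ℝ (EuclideanSpace ℝ (Fin 3)) : ℝ) + 1 < (5 : ℝ) := by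
    rw [finrank_euclideanSpace_fin]; norm_num
  have hr3 : (Module.finrank ℝ (EuclideanSpace ℝ (Fin 3)) : ℝ) < (5 : ℝ) := by linarith
  have hV2 : ContDiff ℝ 2 V := hV.of_le (by norm_cast)
  have hV1 : ContDiff ℝ 1 V := hV.of_le (by norm_cast)
  have hVd : Differentiable ℝ V := hV1.differentiable one_ne_zero
  have hωs : ContDiff ℝ ∞ (curl V) := contDiff_curl (n := ⊤) (hV.of_le (by exact_mod_cast le_top))
  have hω1 : ContDiff ℝ 1 (curl V) := hωs.of_le (by norm_cast)
  have hωd : Differentiable ℝ (curl V) := hω1.differentiable one_ne_zero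
  have hVc : Continuous V := hV.continuous
  have hDVc : Continuous (fderiv ℝ V) := hV.continuous_fderiv (by simp)
  have hωc : Continuous (curl V) := hωs.continuous
  have hDωc : Continuous (fderiv ℝ (curl V)) := hωs.continuous_fderiv (by simp)
  have w0 : ∀ (y : EuclideanSpace ℝ (Fin 3)) (a : ℝ), 0 ≤ (1 + ‖y‖) ^ (-a) := fun y a =>
    Real.rpow_nonneg (by positivity) _
  have w1 : ∀ (y : EuclideanSpace ℝ (Fin 3)) {a : ℝ}, 0 ≤ a → (1 + ‖y‖) ^ (-a) ≤ 1 := fun y a ha =>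
    rpow_neg_le_one y ha
  have norm_mul_weight_le : ∀ (y : EuclideanSpace ℝ (Fin 3)) (a : ℝ),
      ‖y‖ * (1 + ‖y‖) ^ (-a) ≤ (1 + ‖y‖) ^ (-(a - 1)) := fun y a => by
    have h1 : 0 < 1 + ‖y‖ := by positivity
    have : (1 + ‖y‖) ^ (-(a - 1)) = (1 + ‖y‖) * (1 + ‖y‖) ^ (-a) := by
      rw [show -(a - 1) = 1 + -a by ring, Real.rpow_add h1, Real.rpow_one]
    rw [this]
    exact mul_le_mul_of_nonneg_right (by linarith [norm_nonneg y]) (Real.rpow_nonneg h1.le _)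
  set K : ℝ := ‖curlCLM‖ * C with hK
  have hK0 : 0 ≤ K := by positivity
  have aω : ∀ y, ‖curl V y‖ ≤ K * (1 + ‖y‖) ^ (-(6 : ℝ)) := fun y => by
    calc ‖curl V y‖ ≤ ‖curlCLM‖ * ‖fderiv ℝ V y‖ := norm_curl_le _ y
      _ ≤ ‖curlCLM‖ * (C * (1 + ‖y‖) ^ (-(6 : ℝ))) :=
          mul_le_mul_of_nonneg_left (h1 y) (norm_nonneg curlCLM)
      _ = K * (1 + ‖y‖) ^ (-(6 : ℝ)) := by rw [hK]; ring
  have aDω : ∀ y, ‖fderiv ℝ (curl V) y‖ ≤ K * (1 + ‖y‖) ^ (-(6 : ℝ)) := fun y => by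
    rw [fderiv_curl hV2 y]
    calc ‖curlCLM.comp (fderiv ℝ (fderiv ℝ V) y)‖
        ≤ ‖curlCLM‖ * ‖fderiv ℝ (fderiv ℝ V) y‖ := ContinuousLinearMap.opNorm_comp_le _ _
      _ ≤ ‖curlCLM‖ * (C * (1 + ‖y‖) ^ (-(6 : ℝ))) :=
          mul_le_mul_of_nonneg_left (h2 y) (norm_nonneg curlCLM)
      _ = K * (1 + ‖y‖) ^ (-(6 : ℝ)) := by rw [hK]; ring
  have aZ : ∀ y, ‖fderiv ℝ V y y‖ ≤ C * (1 + ‖y‖) ^ (-(5 : ℝ)) := fun y => by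
    calc ‖fderiv ℝ V y y‖ ≤ ‖fderiv ℝ V y‖ * ‖y‖ := ContinuousLinearMap.le_opNorm _ _
      _ ≤ C * (1 + ‖y‖) ^ (-(6 : ℝ)) * ‖y‖ := mul_le_mul_of_nonneg_right (h1 y) (norm_nonneg _)
      _ = C * (‖y‖ * (1 + ‖y‖) ^ (-(6 : ℝ))) := by ring
      _ ≤ C * (1 + ‖y‖) ^ (-(5 : ℝ)) := by
          refine mul_le_mul_of_nonneg_left ?_ hC
          have := norm_mul_weight_le y 6; rwa [show (6 : ℝ) - 1 = 5 by norm_num] at this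
  have aDωy : ∀ y, ‖fderiv ℝ (curl V) y y‖ ≤ K * (1 + ‖y‖) ^ (-(5 : ℝ)) := fun y => by
    calc ‖fderiv ℝ (curl V) y y‖ ≤ ‖fderiv ℝ (curl V) y‖ * ‖y‖ := ContinuousLinearMap.le_opNorm _ _
      _ ≤ K * (1 + ‖y‖) ^ (-(6 : ℝ)) * ‖y‖ := mul_le_mul_of_nonneg_right (aDω y) (norm_nonneg _)
      _ = K * (‖y‖ * (1 + ‖y‖) ^ (-(6 : ℝ))) := by ring
      _ ≤ K * (1 + ‖y‖) ^ (-(5 : ℝ)) := by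
          refine mul_le_mul_of_nonneg_left ?_ hK0
          have := norm_mul_weight_le y 6; rwa [show (6 : ℝ) - 1 = 5 by norm_num] at this
  have aV5 : ∀ y, ‖V y‖ ≤ C * (1 + ‖y‖) ^ (-(5 : ℝ)) := fun y =>
    (h0 y).trans (mul_le_mul_of_nonneg_left (rpow_neg_le_rpow_neg_of_le y (by norm_num)) hC)
  have aDV5 : ∀ y, ‖fderiv ℝ V y‖ ≤ C * (1 + ‖y‖) ^ (-(5 : ℝ)) := fun y =>
    (h1 y).trans (mul_le_mul_of_nonneg_left (rpow_neg_le_rpow_neg_of_le y (by norm_num)) hC)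
  set H : ℝ := ∫ y, ⟪V y, curl V y⟫ with hH
  set J : ℝ := ∫ y, ⟪fderiv ℝ V y y, curl V y⟫ with hJ
  set L : ℝ := ∫ y, ⟪V y, fderiv ℝ (curl V) y y⟫ with hL
  have bH : ∀ y, ‖⟪V y, curl V y⟫‖ ≤ C * K * (1 + ‖y‖) ^ (-(5 : ℝ)) := fun y =>
    norm_inner_le_of_weights (aV5 y) (aω y) hC hK0 (w0 y _) (w1 y (by norm_num))
  have bJ : ∀ y, ‖⟪fderiv ℝ V y y, curl V y⟫‖ ≤ C * K * (1 + ‖y‖) ^ (-(5 : ℝ)) := fun y =>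
    norm_inner_le_of_weights (aZ y) (aω y) hC hK0 (w0 y _) (w1 y (by norm_num))
  have bL : ∀ y, ‖⟪V y, fderiv ℝ (curl V) y y⟫‖ ≤ C * K * (1 + ‖y‖) ^ (-(5 : ℝ)) := fun y => by
    have := norm_inner_le_of_weights (aDωy y) (aV5 y) hK0 hC (w0 y _) (w1 y (by norm_num))
    rw [real_inner_comm] at this  -- `⟪Dω y, V⟫ = ⟪V, Dω y⟫`
    calc ‖⟪V y, fderiv ℝ (curl V) y y⟫‖ ≤ K * C * (1 + ‖y‖) ^ (-(5 : ℝ)) := this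
      _ = C * K * (1 + ‖y‖) ^ (-(5 : ℝ)) := by ring
  have hIH : Integrable fun y => ⟪V y, curl V y⟫ :=
    integrable_of_norm_le_rpow_neg (hVc.inner hωc) (C := C * K) (r := 5) hr3 bH
  have hIJ : Integrable fun y => ⟪fderiv ℝ V y y, curl V y⟫ :=
    integrable_of_norm_le_rpow_neg (by fun_prop : Continuous fun y => ⟪fderiv ℝ V y y, curl V y⟫)
      (C := C * K) (r := 5) hr3 bJ
  have hIL : Integrable fun y => ⟪V y, fderiv ℝ (curl V) y y⟫ :=
    integrable_of_norm_le_rpow_neg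
      (by fun_prop : Continuous fun y => ⟪V y, fderiv ℝ (curl V) y y⟫) (C := C * K) (r := 5) hr3 bL
  -- (★) Green's formula for `Φ y = ⟪V y, ω y⟫ • y`: `3H + L + J = 0`
  set θ : EuclideanSpace ℝ (Fin 3) → ℝ := fun y => ⟪V y, curl V y⟫ with hθ
  have hθ1 : ContDiff ℝ 1 θ := hV1.inner ℝ hω1
  have hθd : Differentiable ℝ θ := hθ1.differentiable one_ne_zero
  have hDθ : ∀ y v, fderiv ℝ θ y v = ⟪V y, fderiv ℝ (curl V) y v⟫ + ⟪fderiv ℝ V y v, curl V y⟫ :=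
    fun y v => fderiv_inner_apply ℝ (hVd y) (hωd y) v
  have hθb : ∀ y, ‖θ y‖ ≤ C * K * (1 + ‖y‖) ^ (-(6 : ℝ)) := fun y =>
    norm_inner_le_of_weights (h0 y) (aω y) hC hK0 (w0 y _) (w1 y (by norm_num))
  have hDθb : ∀ y, ‖fderiv ℝ θ y‖ ≤ 2 * (C * K) * (1 + ‖y‖) ^ (-(6 : ℝ)) := fun y => by
    refine ContinuousLinearMap.opNorm_le_bound _ (by positivity) fun v => ?_
    rw [hDθ y v]
    have e1 : ‖⟪V y, fderiv ℝ (curl V) y v⟫‖ ≤ C * K * (1 + ‖y‖) ^ (-(6 : ℝ)) * ‖v‖ := by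
      have hb : ‖fderiv ℝ (curl V) y v‖ ≤ K * (1 + ‖y‖) ^ (-(6 : ℝ)) * ‖v‖ :=
        (ContinuousLinearMap.le_opNorm _ _).trans (mul_le_mul_of_nonneg_right (aDω y) (norm_nonneg _))
      calc ‖⟪V y, fderiv ℝ (curl V) y v⟫‖ ≤ ‖V y‖ * ‖fderiv ℝ (curl V) y v‖ := norm_inner_le_norm _ _
        _ ≤ C * (1 + ‖y‖) ^ (-(6 : ℝ)) * (K * (1 + ‖y‖) ^ (-(6 : ℝ)) * ‖v‖) :=
            mul_le_mul (h0 y) hb (norm_nonneg _) (mul_nonneg hC (w0 y _))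
        _ = C * K * (1 + ‖y‖) ^ (-(6 : ℝ)) * ‖v‖ * (1 + ‖y‖) ^ (-(6 : ℝ)) := by ring
        _ ≤ C * K * (1 + ‖y‖) ^ (-(6 : ℝ)) * ‖v‖ * 1 :=
            mul_le_mul_of_nonneg_left (w1 y (by norm_num)) (by positivity)
        _ = C * K * (1 + ‖y‖) ^ (-(6 : ℝ)) * ‖v‖ := mul_one _
    have e2 : ‖⟪fderiv ℝ V y v, curl V y⟫‖ ≤ C * K * (1 + ‖y‖) ^ (-(6 : ℝ)) * ‖v‖ := by
      have ha : ‖fderiv ℝ V y v‖ ≤ C * (1 + ‖y‖) ^ (-(6 : ℝ)) * ‖v‖ :=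
        (ContinuousLinearMap.le_opNorm _ _).trans (mul_le_mul_of_nonneg_right (h1 y) (norm_nonneg _))
      calc ‖⟪fderiv ℝ V y v, curl V y⟫‖ ≤ ‖fderiv ℝ V y v‖ * ‖curl V y‖ := norm_inner_le_norm _ _
        _ ≤ C * (1 + ‖y‖) ^ (-(6 : ℝ)) * ‖v‖ * (K * (1 + ‖y‖) ^ (-(6 : ℝ))) :=
            mul_le_mul ha (aω y) (norm_nonneg _) (by positivity)
        _ = C * K * (1 + ‖y‖) ^ (-(6 : ℝ)) * ‖v‖ * (1 + ‖y‖) ^ (-(6 : ℝ)) := by ring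
        _ ≤ C * K * (1 + ‖y‖) ^ (-(6 : ℝ)) * ‖v‖ * 1 :=
            mul_le_mul_of_nonneg_left (w1 y (by norm_num)) (by positivity)
        _ = C * K * (1 + ‖y‖) ^ (-(6 : ℝ)) * ‖v‖ := mul_one _
    calc ‖⟪V y, fderiv ℝ (curl V) y v⟫ + ⟪fderiv ℝ V y v, curl V y⟫‖
        ≤ ‖⟪V y, fderiv ℝ (curl V) y v⟫‖ + ‖⟪fderiv ℝ V y v, curl V y⟫‖ := norm_add_le _ _
      _ ≤ C * K * (1 + ‖y‖) ^ (-(6 : ℝ)) * ‖v‖ + C * K * (1 + ‖y‖) ^ (-(6 : ℝ)) * ‖v‖ :=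
          add_le_add e1 e2
      _ = 2 * (C * K) * (1 + ‖y‖) ^ (-(6 : ℝ)) * ‖v‖ := by ring
  set Φ : EuclideanSpace ℝ (Fin 3) → EuclideanSpace ℝ (Fin 3) := fun y => θ y • y with hΦ
  have hΦ1 : ContDiff ℝ 1 Φ := hθ1.smul contDiff_id
  have hΦd : ∀ y, HasFDerivAt Φ (θ y • ContinuousLinearMap.id ℝ _ + (fderiv ℝ θ y).smulRight y) y :=
    fun y => ((hθd y).hasFDerivAt).smul (hasFDerivAt_id y)
  have hw65 : ∀ y : EuclideanSpace ℝ (Fin 3), ‖y‖ * (1 + ‖y‖) ^ (-(6 : ℝ)) ≤ (1 + ‖y‖) ^ (-(5 : ℝ)) :=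
    fun y => by have := norm_mul_weight_le y 6; rwa [show (6 : ℝ) - 1 = 5 by norm_num] at this
  have hΦb : ∀ y, ‖Φ y‖ ≤ 3 * (C * K) * (1 + ‖y‖) ^ (-(5 : ℝ)) := fun y => by
    have e : ‖Φ y‖ = ‖θ y‖ * ‖y‖ := norm_smul _ _
    rw [e]
    calc ‖θ y‖ * ‖y‖ ≤ C * K * (1 + ‖y‖) ^ (-(6 : ℝ)) * ‖y‖ :=
          mul_le_mul_of_nonneg_right (hθb y) (norm_nonneg _)
      _ = C * K * (‖y‖ * (1 + ‖y‖) ^ (-(6 : ℝ))) := by ring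
      _ ≤ C * K * (1 + ‖y‖) ^ (-(5 : ℝ)) := mul_le_mul_of_nonneg_left (hw65 y) (mul_nonneg hC hK0)
      _ ≤ 3 * (C * K) * (1 + ‖y‖) ^ (-(5 : ℝ)) := by nlinarith [mul_nonneg hC hK0, w0 y (5 : ℝ)]
  have hDΦb : ∀ y, ‖fderiv ℝ Φ y‖ ≤ 3 * (C * K) * (1 + ‖y‖) ^ (-(5 : ℝ)) := fun y => by
    rw [(hΦd y).fderiv]
    have e1 : ‖θ y • ContinuousLinearMap.id ℝ (EuclideanSpace ℝ (Fin 3))‖ ≤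
        C * K * (1 + ‖y‖) ^ (-(5 : ℝ)) := by
      rw [norm_smul]
      calc ‖θ y‖ * ‖ContinuousLinearMap.id ℝ (EuclideanSpace ℝ (Fin 3))‖ ≤ ‖θ y‖ * 1 :=
            mul_le_mul_of_nonneg_left ContinuousLinearMap.norm_id_le (norm_nonneg _)
        _ ≤ C * K * (1 + ‖y‖) ^ (-(6 : ℝ)) := by rw [mul_one]; exact hθb y
        _ ≤ C * K * (1 + ‖y‖) ^ (-(5 : ℝ)) :=
            mul_le_mul_of_nonneg_left (rpow_neg_le_rpow_neg_of_le y (by norm_num)) (mul_nonneg hC hK0)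
    have e2 : ‖(fderiv ℝ θ y).smulRight y‖ ≤ 2 * (C * K) * (1 + ‖y‖) ^ (-(5 : ℝ)) := by
      rw [ContinuousLinearMap.norm_smulRight_apply]
      calc ‖fderiv ℝ θ y‖ * ‖y‖ ≤ 2 * (C * K) * (1 + ‖y‖) ^ (-(6 : ℝ)) * ‖y‖ :=
            mul_le_mul_of_nonneg_right (hDθb y) (norm_nonneg _)
        _ = 2 * (C * K) * (‖y‖ * (1 + ‖y‖) ^ (-(6 : ℝ))) := by ring
        _ ≤ 2 * (C * K) * (1 + ‖y‖) ^ (-(5 : ℝ)) :=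
            mul_le_mul_of_nonneg_left (hw65 y) (by positivity)
    calc ‖θ y • ContinuousLinearMap.id ℝ _ + (fderiv ℝ θ y).smulRight y‖
        ≤ ‖θ y • ContinuousLinearMap.id ℝ (EuclideanSpace ℝ (Fin 3))‖ +
            ‖(fderiv ℝ θ y).smulRight y‖ := norm_add_le _ _
      _ ≤ C * K * (1 + ‖y‖) ^ (-(5 : ℝ)) + 2 * (C * K) * (1 + ‖y‖) ^ (-(5 : ℝ)) := add_le_add e1 e2
      _ = 3 * (C * K) * (1 + ‖y‖) ^ (-(5 : ℝ)) := by ring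
  have hGreen := integral_divergence_eq_zero_of_decay hΦ1 (r := 5) hr4 hΦb hDΦb
  -- `div Φ = 3 θ + ⟪V, Dω y⟫ + ⟪DV y, ω⟫`
  have hdivid : ∀ y : EuclideanSpace ℝ (Fin 3),
      VectorCalculus.divergence (fun x : EuclideanSpace ℝ (Fin 3) => x) y = 3 := fun y => by
    rw [VectorCalculus.divergence, fderiv_fun_id]
    have := LinearMap.trace_id ℝ (EuclideanSpace ℝ (Fin 3))
    rw [finrank_euclideanSpace_fin] at this
    exact_mod_cast this
  have hdiv : ∀ y, VectorCalculus.divergence Φ y =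
      3 * θ y + (⟪V y, fderiv ℝ (curl V) y y⟫ + ⟪fderiv ℝ V y y, curl V y⟫) := fun y => by
    have hsm := divergence_smul_apply (u := fun x : EuclideanSpace ℝ (Fin 3) => x) (hθd y)
      differentiableAt_id
    rw [hΦ]
    rw [hsm, hdivid, real_inner_comm, gradient, InnerProductSpace.toDual_symm_apply, hDθ]
    ring
  have hstar : 3 * H + L + J = 0 := by
    have e : (fun y => VectorCalculus.divergence Φ y) =
        fun y => 3 * θ y + (⟪V y, fderiv ℝ (curl V) y y⟫ + ⟪fderiv ℝ V y y, curl V y⟫) :=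
      funext hdiv
    have hI1 : Integrable (fun y => 3 * θ y) := hIH.const_mul 3
    have hI2 : Integrable (fun y => ⟪V y, fderiv ℝ (curl V) y y⟫ + ⟪fderiv ℝ V y y, curl V y⟫) :=
      hIL.add hIJ
    rw [e, integral_add hI1 hI2, integral_add hIL hIJ, integral_const_mul] at hGreen
    rw [hH, hL, hJ]
    linarith
  -- (★★) self-adjointness of the curl against `Ψ = (y·∇)V`: `J = L + H`
  set Ψ : EuclideanSpace ℝ (Fin 3) → EuclideanSpace ℝ (Fin 3) := fun y => fderiv ℝ V y y with hΨ
  have hΨeq : Ψ = convect (fun y : EuclideanSpace ℝ (Fin 3) => y) V := by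
    funext y; simp [hΨ, convect_apply]
  have hΨd : ∀ y, HasFDerivAt Ψ (fderiv ℝ V y + (fderiv ℝ (fderiv ℝ V) y).flip y) y := fun y => by
    have hD : HasFDerivAt (fderiv ℝ V) (fderiv ℝ (fderiv ℝ V) y) y :=
      (((hV2.fderiv_right (m := 1) (by norm_num)).differentiable one_ne_zero) y).hasFDerivAt
    have := hD.clm_apply (hasFDerivAt_id y)
    simpa [hΨ] using this
  have hΨ1 : ContDiff ℝ 1 Ψ := by
    rw [hΨeq]
    exact ((hV2.fderiv_right (m := 1) (by norm_num)).clm_apply contDiff_id)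
  have hΨ0b : ∀ y, ‖Ψ y‖ ≤ 2 * C * (1 + ‖y‖) ^ (-(5 : ℝ)) := fun y =>
    (aZ y).trans (by nlinarith [hC, w0 y (5 : ℝ)])
  have hΨ1b : ∀ y, ‖fderiv ℝ Ψ y‖ ≤ 2 * C * (1 + ‖y‖) ^ (-(5 : ℝ)) := fun y => by
    rw [(hΨd y).fderiv]
    have e2 : ‖(fderiv ℝ (fderiv ℝ V) y).flip y‖ ≤ C * (1 + ‖y‖) ^ (-(5 : ℝ)) := by
      calc ‖(fderiv ℝ (fderiv ℝ V) y).flip y‖ ≤ ‖(fderiv ℝ (fderiv ℝ V) y).flip‖ * ‖y‖ :=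
            ContinuousLinearMap.le_opNorm _ _
        _ = ‖fderiv ℝ (fderiv ℝ V) y‖ * ‖y‖ := by rw [ContinuousLinearMap.opNorm_flip]
        _ ≤ C * (1 + ‖y‖) ^ (-(6 : ℝ)) * ‖y‖ := mul_le_mul_of_nonneg_right (h2 y) (norm_nonneg _)
        _ = C * (‖y‖ * (1 + ‖y‖) ^ (-(6 : ℝ))) := by ring
        _ ≤ C * (1 + ‖y‖) ^ (-(5 : ℝ)) := mul_le_mul_of_nonneg_left (hw65 y) hC
    calc ‖fderiv ℝ V y + (fderiv ℝ (fderiv ℝ V) y).flip y‖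
        ≤ ‖fderiv ℝ V y‖ + ‖(fderiv ℝ (fderiv ℝ V) y).flip y‖ := norm_add_le _ _
      _ ≤ C * (1 + ‖y‖) ^ (-(5 : ℝ)) + C * (1 + ‖y‖) ^ (-(5 : ℝ)) := add_le_add (aDV5 y) e2
      _ = 2 * C * (1 + ‖y‖) ^ (-(5 : ℝ)) := by ring
  have h0' : ∀ y, ‖V y‖ ≤ 2 * C * (1 + ‖y‖) ^ (-(5 : ℝ)) := fun y =>
    (aV5 y).trans (by nlinarith [hC, w0 y (5 : ℝ)])
  have h1' : ∀ y, ‖fderiv ℝ V y‖ ≤ 2 * C * (1 + ‖y‖) ^ (-(5 : ℝ)) := fun y =>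
    (aDV5 y).trans (by nlinarith [hC, w0 y (5 : ℝ)])
  have hadj := integral_inner_curl_eq_integral_inner_curl_of_decay hV1 hΨ1 (C := 2 * C) (r := 5)
    (by positivity) (by norm_num) h0' h1' hΨ0b hΨ1b
  -- `curl Ψ = (y·∇)ω + ω`
  have hcurlΨ : ∀ y, curl Ψ y = fderiv ℝ (curl V) y y + curl V y := fun y => by
    rw [hΨeq, curl_convect (a := fun y : EuclideanSpace ℝ (Fin 3) => y) contDiff_id hV2 y, convect_apply,
      fderiv_fun_id, ContinuousLinearMap.comp_id,
      ← curl_eq_curlCLM]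
  have hstar2 : J = L + H := by
    have e1 : ∫ y, ⟪curl V y, Ψ y⟫ = J := by
      rw [hJ]; exact integral_congr_ae (Eventually.of_forall fun y => real_inner_comm _ _)
    have e2 : ∫ y, ⟪V y, curl Ψ y⟫ = L + H := by
      simp_rw [hcurlΨ, inner_add_right]
      rw [integral_add hIL hIH]
    rw [← e1, hadj, e2]
  -- conclude `J = -H`
  change J = -H
  linarith

/-- **The similarity drift does no work against the vorticity**: for smooth `V` on `ℝ³` with `V`,
`DV`, `D²V` decaying like `(1+|y|)^{-6}`, `∫ ⟪−(ε/2)(V + DV·y), curl V⟫ = 0`.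
[cite: MajdaBertozziCUP2002, §1.7 Prop. 1.12 (iv) (helicity; scaling generator)] -/
theorem integral_inner_drift_curl_eq_zero
    {V : EuclideanSpace ℝ (Fin 3) → EuclideanSpace ℝ (Fin 3)} (hV : ContDiff ℝ ∞ V) {C : ℝ}
    (h0 : ∀ y, ‖V y‖ ≤ C * (1 + ‖y‖) ^ (-(6 : ℝ)))
    (h1 : ∀ y, ‖fderiv ℝ V y‖ ≤ C * (1 + ‖y‖) ^ (-(6 : ℝ)))
    (h2 : ∀ y, ‖fderiv ℝ (fderiv ℝ V) y‖ ≤ C * (1 + ‖y‖) ^ (-(6 : ℝ))) (ε : ℝ) :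
    ∫ y, ⟪-((ε / 2) • (V y + fderiv ℝ V y y)), curl V y⟫ = 0 := by
  have hkey := integral_inner_convect_id_curl_eq_neg_helicity hV h0 h1 h2
  have hC : 0 ≤ C := by have := (norm_nonneg _).trans (h0 0); simpa using this
  have hr3 : (Module.finrank ℝ (EuclideanSpace ℝ (Fin 3)) : ℝ) < (5 : ℝ) := by
    rw [finrank_euclideanSpace_fin]; norm_num
  have hV1 : ContDiff ℝ 1 V := hV.of_le (by norm_cast)
  have hVc : Continuous V := hV.continuous
  have hDVc : Continuous (fderiv ℝ V) := hV.continuous_fderiv (by simp)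
  have hωc : Continuous (curl V) := continuous_curl hV1
  have w0 : ∀ (y : EuclideanSpace ℝ (Fin 3)) (a : ℝ), 0 ≤ (1 + ‖y‖) ^ (-a) := fun y a =>
    Real.rpow_nonneg (by positivity) _
  have norm_mul_weight_le : ∀ (y : EuclideanSpace ℝ (Fin 3)) (a : ℝ),
      ‖y‖ * (1 + ‖y‖) ^ (-a) ≤ (1 + ‖y‖) ^ (-(a - 1)) := fun y a => by
    have h1 : 0 < 1 + ‖y‖ := by positivity
    have : (1 + ‖y‖) ^ (-(a - 1)) = (1 + ‖y‖) * (1 + ‖y‖) ^ (-a) := by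
      rw [show -(a - 1) = 1 + -a by ring, Real.rpow_add h1, Real.rpow_one]
    rw [this]
    exact mul_le_mul_of_nonneg_right (by linarith [norm_nonneg y]) (Real.rpow_nonneg h1.le _)
  have aω : ∀ y, ‖curl V y‖ ≤ ‖curlCLM‖ * C * (1 + ‖y‖) ^ (-(6 : ℝ)) := fun y => by
    calc ‖curl V y‖ ≤ ‖curlCLM‖ * ‖fderiv ℝ V y‖ := norm_curl_le _ y
      _ ≤ ‖curlCLM‖ * (C * (1 + ‖y‖) ^ (-(6 : ℝ))) :=
          mul_le_mul_of_nonneg_left (h1 y) (norm_nonneg curlCLM)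
      _ = ‖curlCLM‖ * C * (1 + ‖y‖) ^ (-(6 : ℝ)) := by ring
  have aV5 : ∀ y, ‖V y‖ ≤ C * (1 + ‖y‖) ^ (-(5 : ℝ)) := fun y =>
    (h0 y).trans (mul_le_mul_of_nonneg_left (rpow_neg_le_rpow_neg_of_le y (by norm_num)) hC)
  have aZ : ∀ y, ‖fderiv ℝ V y y‖ ≤ C * (1 + ‖y‖) ^ (-(5 : ℝ)) := fun y => by
    calc ‖fderiv ℝ V y y‖ ≤ ‖fderiv ℝ V y‖ * ‖y‖ := ContinuousLinearMap.le_opNorm _ _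
      _ ≤ C * (1 + ‖y‖) ^ (-(6 : ℝ)) * ‖y‖ := mul_le_mul_of_nonneg_right (h1 y) (norm_nonneg _)
      _ = C * (‖y‖ * (1 + ‖y‖) ^ (-(6 : ℝ))) := by ring
      _ ≤ C * (1 + ‖y‖) ^ (-(5 : ℝ)) := by
          refine mul_le_mul_of_nonneg_left ?_ hC
          have := norm_mul_weight_le y 6; rwa [show (6 : ℝ) - 1 = 5 by norm_num] at this
  have hIH : Integrable fun y => ⟪V y, curl V y⟫ :=
    integrable_of_norm_le_rpow_neg (hVc.inner hωc) (C := C * (‖curlCLM‖ * C)) (r := 5) hr3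
      fun y => norm_inner_le_of_weights (aV5 y) (aω y) hC (by positivity) (w0 y _)
        (rpow_neg_le_one y (by norm_num))
  have hIJ : Integrable fun y => ⟪fderiv ℝ V y y, curl V y⟫ :=
    integrable_of_norm_le_rpow_neg (by fun_prop : Continuous fun y => ⟪fderiv ℝ V y y, curl V y⟫)
      (C := C * (‖curlCLM‖ * C)) (r := 5) hr3
      fun y => norm_inner_le_of_weights (aZ y) (aω y) hC (by positivity) (w0 y _)
        (rpow_neg_le_one y (by norm_num))
  have hpt : ∀ y, ⟪-((ε / 2) • (V y + fderiv ℝ V y y)), curl V y⟫ =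
      -(ε / 2) * ⟪V y, curl V y⟫ + -(ε / 2) * ⟪fderiv ℝ V y y, curl V y⟫ := fun y => by
    rw [inner_neg_left, real_inner_smul_left, inner_add_left]; ring
  simp_rw [hpt]
  rw [integral_add (hIH.const_mul _) (hIJ.const_mul _), integral_const_mul, integral_const_mul,
    hkey]
  ring

/-- **Law (iv) of the item — the helicity law of the rescaled Euler–Leray system** (as typed):
`d/dσ helicity(W σ) = −2ε ∫ ⟪curl W, curl curl W⟫`. Proof: the forced helicity balance
(`hasDerivWithinAt_helicity_forced`) on `univ`, where the force `f = −(ε/2)(W + DW·y)` has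
continuous bounded slices and `∫ ⟪f, curl W⟫ = 0` (`integral_inner_drift_curl_eq_zero`).
[cite: FrischTurbulence1995, §2.3 eqs. (2.24), (2.29)] [cite: MajdaBertozziCUP2002, §1.7 Prop. 1.12 (iv)] -/
theorem helicity_law {ε : ℝ} {W : ℝ → EuclideanSpace ℝ (Fin 3) → EuclideanSpace ℝ (Fin 3)}
    {q : ℝ → EuclideanSpace ℝ (Fin 3) → ℝ}
    (h : IsClassicalNSSolutionOn univ ε (fun σ y => -((ε / 2) • (W σ y + fderiv ℝ (W σ) y y))) W q)
    (hu : HasUniformRapidDecayOn univ W) (σ : ℝ) :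
    HasDerivAt (fun s => helicity (W s))
      (-(2 * ε) * ∫ y, ⟪curl (W σ) y, curl (curl (W σ)) y⟫) σ := by
  have hsm := h.smooth_velocity
  have hU : UniqueDiffOn ℝ (univ : Set ℝ) := uniqueDiffOn_univ
  obtain ⟨A0, hA0, hA0b⟩ := hu.norm_le_rpow 6
  obtain ⟨A1, hA1, hA1b⟩ := hu.norm_fderiv_le_rpow hsm hU 6
  obtain ⟨A2, hA2, hA2b⟩ := hu.norm_fderiv_fderiv_le_rpow hsm hU 6
  set C : ℝ := A0 + A1 + A2 with hC_def
  have hC : 0 ≤ C := by positivity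
  have h0 : ∀ s y, ‖W s y‖ ≤ C * (1 + ‖y‖) ^ (-(6 : ℝ)) := fun s y =>
    le_decay_of_le_decay y (by exact_mod_cast hA0b s (mem_univ s) y) (by rw [hC_def]; linarith)
  have h1 : ∀ s y, ‖fderiv ℝ (W s) y‖ ≤ C * (1 + ‖y‖) ^ (-(6 : ℝ)) := fun s y =>
    le_decay_of_le_decay y (by exact_mod_cast hA1b s (mem_univ s) y) (by rw [hC_def]; linarith)
  have h2 : ∀ s y, ‖fderiv ℝ (fderiv ℝ (W s)) y‖ ≤ C * (1 + ‖y‖) ^ (-(6 : ℝ)) := fun s y =>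
    le_decay_of_le_decay y (by exact_mod_cast hA2b s (mem_univ s) y) (by rw [hC_def]; linarith)
  have hV : ∀ s, ContDiff ℝ ∞ (W s) := fun s => h.contDiff_velocity (mem_univ s)
  -- continuity and a uniform bound of the force slices
  have hfc : ∀ s ∈ (univ : Set ℝ),
      Continuous ((fun σ y => -((ε / 2) • (W σ y + fderiv ℝ (W σ) y y))) s) := by
    intro s _
    have hVc : Continuous (W s) := (hV s).continuous
    have hDVc : Continuous (fderiv ℝ (W s)) := (hV s).continuous_fderiv (by simp)
    exact (by fun_prop : Continuous fun y => -((ε / 2) • (W s y + fderiv ℝ (W s) y y)))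
  have hw65 : ∀ y : EuclideanSpace ℝ (Fin 3), ‖y‖ * (1 + ‖y‖) ^ (-(6 : ℝ)) ≤ (1 + ‖y‖) ^ (-(5 : ℝ)) :=
    fun y => by
    have h1 : 0 < 1 + ‖y‖ := by positivity
    rw [show (-(5 : ℝ)) = 1 + -(6 : ℝ) by norm_num, Real.rpow_add h1, Real.rpow_one]
    exact mul_le_mul_of_nonneg_right (by linarith [norm_nonneg y]) (Real.rpow_nonneg h1.le _)
  have hfb : ∀ s ∈ (univ : Set ℝ), ∀ y,
      ‖(fun σ y => -((ε / 2) • (W σ y + fderiv ℝ (W σ) y y))) s y‖ ≤ |ε| / 2 * (C + C) := by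
    intro s _ y
    dsimp only
    rw [norm_neg, norm_smul, Real.norm_eq_abs, abs_div, abs_two]
    refine mul_le_mul_of_nonneg_left ((norm_add_le _ _).trans (add_le_add ?_ ?_)) (by positivity)
    · exact (h0 s y).trans (mul_le_of_le_one_right hC (rpow_neg_le_one y (by norm_num)))
    · calc ‖fderiv ℝ (W s) y y‖ ≤ ‖fderiv ℝ (W s) y‖ * ‖y‖ := ContinuousLinearMap.le_opNorm _ _
        _ ≤ C * (1 + ‖y‖) ^ (-(6 : ℝ)) * ‖y‖ := mul_le_mul_of_nonneg_right (h1 s y) (norm_nonneg _)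
        _ = C * (‖y‖ * (1 + ‖y‖) ^ (-(6 : ℝ))) := by ring
        _ ≤ C * (1 + ‖y‖) ^ (-(5 : ℝ)) := mul_le_mul_of_nonneg_left (hw65 y) hC
        _ ≤ C := mul_le_of_le_one_right hC (rpow_neg_le_one y (by norm_num))
  have hbal := hasDerivWithinAt_helicity_forced h convex_univ hu (mem_univ σ) hfc hfb
  have hdrift : ∫ y, ⟪(fun σ y => -((ε / 2) • (W σ y + fderiv ℝ (W σ) y y))) σ y, curl (W σ) y⟫ = 0 :=
    integral_inner_drift_curl_eq_zero (hV σ) (h0 σ) (h1 σ) (h2 σ) ε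
  rw [hdrift, mul_zero, add_zero] at hbal
  have hder := hbal.hasDerivAt (Filter.univ_mem)
  have hval : -(2 * ε * superhelicity (W σ)) =
      -(2 * ε) * ∫ y, ⟪curl (W σ) y, curl (curl (W σ)) y⟫ := by
    rw [superhelicity_eq_integral_inner]; ring
  rw [hval] at hder
  exact hder

end PeriodMomentLaws

end Summit.NavierStokesRegularity.NavierStokesRegularity.Theorems

end
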